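import Mathlib.FieldTheory.SeparablyGenerated
import Mathlib.FieldTheory.PrimitiveElement
import Mathlib.FieldTheory.Minpoly.IsIntegrallyClosed
import Mathlib.RingTheory.AlgebraicIndependent.Adjoin
import Mathlib.RingTheory.Localization.Integral
import Mathlib.RingTheory.Polynomial.UniqueFactorization
import Mathlib.RingTheory.Polynomial.RationalRoot
import Mathlib.Algebra.MvPolynomial.Equiv
import Literature.RingTheory.KrullDimension.AffineDimension
import HarnessLib

/-!
# A birational hypersurface model of an affine variety over a perfect field, in coordinates

Topic `Literature/RingTheory/NoetherNormalization`.  Let `K` be a PERFECT field and `P` a prime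
ideal of `K[X₁, …, Xₙ]`, `A = K[X]/P` (an affine domain of dimension `d`), `F = Frac A`.
Classically (Hartshorne, *Algebraic Geometry*, I Prop. 4.9: "any variety of dimension `r` is
birational to a hypersurface in `𝐏^{r+1}`"; proof: separating transcendence basis + primitive
element), `F = K(y₁, …, y_d, u)` with `y` algebraically independent and `u` separable algebraic
over `K(y)`; the minimal polynomial `m(y; T)` of `u` cuts out the hypersurface.  This file proves a
COORDINATE-LEVEL version sufficient for point counting (`HypersurfaceModel`, shown to exist in
`HypersurfaceModel.nonempty`): there are

* `d = dim A` and distinct coordinates `emb : Fin d ↪ Fin n` such that `x_{emb 1}, …, x_{emb d}`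
  is a separating transcendence basis of `F/K` (for `K` perfect a separating transcendence basis
  can be extracted from any finite generating family — Mathlib's
  `exists_isTranscendenceBasis_and_isSeparable_of_linearIndepOn_pow'`, iterated here as
  `exists_finset_isTranscendenceBasis_and_isSeparable_of_perfectField`);
* a polynomial `U ∈ K[X]` whose class `u` is a primitive element of `F` over `K₀ = K(y)`,
  integral over `R = K[y] = K[Y₁, …, Y_d]`, with minimal polynomial `m ∈ R[T]` (monic, irreducible
  in `R[T]`, of positive degree; `m(X∘emb, U) ∈ P`);
* `δ ∈ R ∖ 0` and `w_j ∈ R[T]` with `δ(X∘emb)·X_j - w_j(X∘emb, U) ∈ P` for every `j`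
  (the coordinates are polynomials in `u` over `K₀`; clear denominators);
* a Bézout identity `a m + b ∂_T m = ρ ∈ R ∖ 0` (separability of `u`);
* and the POINT-LEVEL surjectivity: for `(y, v) ∈ K^d × K` with `m(y, v) = 0 ≠ δ(y)`, the point
  `x* = (w_j(y, v)/δ(y))_j ∈ Kⁿ` is a `K`-point of `V(P)` with `x*∘emb = y` and `U(x*) = v`.

So `x ↦ (x∘emb, U x)` is a bijection from `V(P)(K) ∩ {δ(x∘emb) ≠ 0}` onto
`{(y, v) | m(y, v) = 0, δ(y) ≠ 0}`; no algebraic closure, scheme or morphism is used.  The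
surjectivity is proved WITHOUT ring-homomorphism plumbing, through the "weighted homogenisation"
`homog δ w g = Σ_e g_e δ^{N-|e|} ∏ w_j^{e_j} ∈ R[T]` of `g ∈ K[X]` (`N = deg g`): under any
homomorphism `φ : R[T] → L` to a field with `φ(δ) ≠ 0` one has
`φ(homog g) = φ(δ)^N g(φ(w)/φ(δ))` (`map_homog_eq`); with `φ = (T ↦ u)` into `F` this is
`δ^N g(x) = 0` for `g ∈ P`, so `m ∣ homog g` in `R[T]` (`minpoly.isIntegrallyClosed_dvd`), and with
`φ = (Y ↦ y, T ↦ v)` into `K` it gives `g(x*) = 0`.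

Used by `RationalTraceDecomposition.lean` (Lang–Weil for arbitrary affine algebraic sets).

## References

* R. Hartshorne, *Algebraic Geometry*, GTM 52 (1977), Ch. I, Prop. 4.9 and Thm. 4.8A, 4.7A
  (separating transcendence bases, primitive element). [Hartshorne1977]
* H. Matsumura, *Commutative Ring Theory* (1986), Thm. 5.6 (`dim = trdeg`). [Matsumura1987]
-/

noncomputable section

open scoped IntermediateField Polynomial
open MvPolynomial IntermediateField

namespace Literature.RingTheory.NoetherNormalization

section SepTB

variable {k K ι : Type*} [Field k] [Field K] [Algebra k K] [Finite ι]

omit [Finite ι] in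
/-- Reindexing a transcendence basis contained in the range of a family by indices. [folklore] -/
theorem isTranscendenceBasis_reindex (a : ι → K) {t : Set K}
    (ht : IsTranscendenceBasis k ((↑) : t → K)) (g : t → ι) (hg : ∀ x, a (g x) = x)
    (s₀ : Finset ι) (hs₀ : ∀ i, i ∈ s₀ ↔ i ∈ Set.range g) :
    IsTranscendenceBasis k (fun i : (s₀ : Set ι) => a i) := by
  classical
  have hmem : ∀ i : (s₀ : Set ι), ∃ x, g x = i := fun i => (hs₀ i.1).1 i.2
  choose e he using hmem
  have hginj : Function.Injective g := fun x y hxy => by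
    apply Subtype.ext
    rw [← hg x, ← hg y, hxy]
  have hbij : Function.Bijective e := by
    constructor
    · intro i j hij
      apply Subtype.ext
      rw [← he i, ← he j, hij]
    · intro x
      refine ⟨⟨g x, (hs₀ _).2 ⟨x, rfl⟩⟩, hginj ?_⟩
      rw [he]
  have h := ht.comp_equiv (Equiv.ofBijective e hbij)
  convert h using 1
  funext i
  simp only [Function.comp_apply, Equiv.ofBijective_apply]
  rw [← hg (e i), he]

/-- Characteristic-`p` engine (the argument of Mathlib's
`exists_isTranscendenceBasis_and_isSeparable_of_linearIndepOn_pow_of_essFiniteType`, restricted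
to index sets inside the given finite family): if `K/k` is generated by the finite family `a`
and `p`-th powers preserve `k`-linear independence, some subfamily of `a` is a separating
transcendence basis (minimise the inseparable degree `[K : K_sep]` over transcendence bases
extracted from `a`; a non-separable generator would allow an exchange increasing the separable
closure). [folklore] -/
theorem exists_finset_isTranscendenceBasis_and_isSeparable_of_linearIndepOn_pow
    (p : ℕ) (hp : p.Prime) [ExpChar k p]
    (H : ∀ s : Finset K,
      LinearIndepOn k _root_.id (s : Set K) → LinearIndepOn k (· ^ p) (s : Set K))
    (a : ι → K) (ha : IntermediateField.adjoin k (Set.range a) = ⊤) :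
    ∃ s : Finset ι, IsTranscendenceBasis k (fun i : (s : Set ι) => a i) ∧
      Algebra.IsSeparable (adjoin k (a '' (s : Set ι))) K := by
  classical
  -- candidates: index sets carrying a transcendence basis
  set T : Set (Finset ι) := {s | IsTranscendenceBasis k (fun i : (s : Set ι) => a i)} with hT
  have hTne : T.Nonempty := by
    -- a transcendence basis inside the generating set `range a`
    have halg : Algebra.IsAlgebraic (Algebra.adjoin k (Set.range a)) K := by
      rw [← IntermediateField.isAlgebraic_adjoin_iff_top, ha,
        Algebra.isAlgebraic_iff_isIntegral]
      exact Algebra.isIntegral_of_surjective topEquiv.surjective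
    obtain ⟨t, hts, ht⟩ := exists_isTranscendenceBasis_subset (R := k) (Set.range a)
    -- choose indices
    have hsec : ∀ x : t, ∃ i : ι, a i = x := fun x => hts x.2
    choose g hg using hsec
    refine ⟨(Set.toFinite (Set.range g)).toFinset, ?_⟩
    simp only [hT, Set.mem_setOf_eq]
    exact isTranscendenceBasis_reindex a ht g hg _ (fun i => Set.Finite.mem_toFinset _)
  have hTfin : T.Finite := Set.toFinite T
  -- minimise the inseparable degree
  let d : Finset ι → ℕ := fun s => Field.finInsepDegree (adjoin k (a '' (s : Set ι))) K
  obtain ⟨s, hsT, hsmin⟩ := hTfin.exists_minimalFor d T hTne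
  have hs : IsTranscendenceBasis k (fun i : (s : Set ι) => a i) := hsT
  refine ⟨s, hs, ?_⟩
  -- every generator is separable over `k(a '' s)`
  have himage : ∀ s' : Finset ι, a '' (s' : Set ι) = Set.range (fun i : (s' : Set ι) => a i) := by
    intro s'; ext x; simp
  haveI : Algebra.IsAlgebraic (adjoin k (a '' (s : Set ι))) K := by
    rw [himage]; exact hs.isAlgebraic_field
  have hEss : Algebra.EssFiniteType k K := by
    rw [← IntermediateField.fg_top_iff]
    exact ⟨(Set.toFinite (Set.range a)).toFinset, by simpa using ha⟩
  haveI : Module.Finite (adjoin k (a '' (s : Set ι))) K := by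
    apply +allowSynthFailures Algebra.finite_of_essFiniteType_of_isAlgebraic
    exact .of_comp k _ _
  rw [← separableClosure.eq_top_iff, ← (restrictScalars_injective k).eq_iff, restrictScalars_top,
    eq_top_iff, ← ha, adjoin_le_iff]
  rintro _ ⟨n, rfl⟩
  by_contra hn
  have hns : n ∉ (s : Set ι) := fun h =>
    hn (le_restrictScalars_separableClosure _ (subset_adjoin _ _ ⟨n, h, rfl⟩))
  obtain ⟨i, hi₁, hi₂⟩ := exists_isTranscendenceBasis_and_isSeparable_of_linearIndepOn_pow'
    p hp H (a := a) (s : Set ι) n hs hns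
  -- the new index set
  set s' : Finset ι := (insert n s).erase i with hs'
  have hcoe : ((s' : Finset ι) : Set ι) = insert n (s : Set ι) \ {i} := by
    rw [hs']; ext j; simp [and_comm]
  have hs'T : s' ∈ T := by
    simp only [hT, Set.mem_setOf_eq]
    rw [hcoe]; exact hi₁
  -- strict growth of the separable closure
  have hlt : (separableClosure (adjoin k (a '' (s : Set ι))) K).restrictScalars k <
      (separableClosure (adjoin k (a '' (s' : Set ι))) K).restrictScalars k := by
    rw [hcoe]
    refine SetLike.lt_iff_le_and_exists.mpr ⟨?_, a n, ?_, hn⟩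
    · rw [separableClosure_le_separableClosure_iff, adjoin_le_iff]
      rintro x ⟨j, hj, rfl⟩
      obtain rfl | ne := eq_or_ne j i
      · exact hi₂
      · exact le_restrictScalars_separableClosure _ (subset_adjoin _ _ ⟨j, ⟨.inr hj, ne⟩, rfl⟩)
    · obtain rfl | ne := eq_or_ne n i
      · exact hi₂
      · exact le_restrictScalars_separableClosure _ (subset_adjoin _ _ ⟨n, ⟨.inl rfl, ne⟩, rfl⟩)
  -- contradiction with minimality of the inseparable degree
  haveI : Algebra.IsAlgebraic (adjoin k (a '' (s' : Set ι))) K := by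
    rw [himage]; rw [hcoe]; exact hi₁.isAlgebraic_field
  haveI : Module.Finite (adjoin k (a '' (s : Set ι))) K := inferInstance
  haveI : Module.Finite ((separableClosure (adjoin k (a '' (s : Set ι))) K).restrictScalars k) K :=
    inferInstanceAs <| Module.Finite (separableClosure (adjoin k (a '' (s : Set ι))) K) K
  have hdlt : d s' < d s := by
    apply finrank_lt_of_gt hlt
  exact absurd (hsmin hs'T hdlt.le) (not_le.mpr hdlt)

/-- **Separating transcendence bases inside a generating family (perfect base field).** If the
field extension `K/k`, `k` perfect, is generated by a finite family `a : ι → K`, then for some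
`s ⊆ ι` the subfamily `(a i)_{i ∈ s}` is a transcendence basis of `K/k` over which `K` is
separable (Hartshorne I Thm. 4.8A / Matsumura Thm. 26.2; characteristic `0`: any transcendence
basis inside the family). [cite: Hartshorne1977, Ch. I Thm. 4.8A] -/
theorem exists_finset_isTranscendenceBasis_and_isSeparable_of_perfectField [PerfectField k]
    (a : ι → K) (ha : IntermediateField.adjoin k (Set.range a) = ⊤) :
    ∃ s : Finset ι, IsTranscendenceBasis k (fun i : (s : Set ι) => a i) ∧
      Algebra.IsSeparable (adjoin k (a '' (s : Set ι))) K := by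
  classical
  obtain _ | ⟨p, hp, hpk⟩ := CharP.exists' k
  · -- characteristic zero: any transcendence basis inside the family will do
    have halg : Algebra.IsAlgebraic (Algebra.adjoin k (Set.range a)) K := by
      rw [← IntermediateField.isAlgebraic_adjoin_iff_top, ha,
        Algebra.isAlgebraic_iff_isIntegral]
      exact Algebra.isIntegral_of_surjective topEquiv.surjective
    obtain ⟨t, hts, ht⟩ := exists_isTranscendenceBasis_subset (R := k) (Set.range a)
    have hsec : ∀ x : t, ∃ i : ι, a i = x := fun x => hts x.2
    choose g hg using hsec
    have hb := isTranscendenceBasis_reindex a ht g hg (Set.toFinite (Set.range g)).toFinset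
      (fun i => Set.Finite.mem_toFinset _)
    refine ⟨(Set.toFinite (Set.range g)).toFinset, hb, ?_⟩
    have himage : ∀ s' : Finset ι, a '' (s' : Set ι) = Set.range (fun i : (s' : Set ι) => a i) := by
      intro s'; ext x; simp
    have : Algebra.IsAlgebraic (adjoin k (a '' ((Set.toFinite (Set.range g)).toFinset : Set ι))) K := by
      rw [himage]; exact hb.isAlgebraic_field
    infer_instance
  · haveI := hp
    have : ExpChar k p := .prime hp.out
    have : CharP K p := .of_ringHom_of_ne_zero (algebraMap k K) p hp.out.ne_zero
    refine exists_finset_isTranscendenceBasis_and_isSeparable_of_linearIndepOn_pow p hp.out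
      (fun s hs ↦ ?_) a ha
    apply hs.map_of_injective_injective (frobeniusEquiv k p).symm (frobenius K p).toAddMonoidHom <;>
      simp [frobenius, Algebra.smul_def, mul_pow, ← map_pow, frobeniusEquiv_symm_pow]

end SepTB
/-! ### The coordinate ring, its fraction field, the coordinate functions -/

section Setup

variable {K : Type*} [Field K] {n : ℕ} (P : Ideal (MvPolynomial (Fin n) K)) [P.IsPrime]

/-- The affine coordinate ring `A = K[X₁, …, Xₙ]/P` (local abbreviation). [folklore] -/
abbrev Aff : Type _ := MvPolynomial (Fin n) K ⧸ P

/-- Its total ring of fractions `F = Frac A` (the function field when `P` is prime).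
[folklore] -/
abbrev Fun : Type _ := FractionRing (Aff P)

/-- The coordinate functions `x_j ∈ F`. [folklore] -/
def xF (j : Fin n) : Fun P := algebraMap (Aff P) (Fun P) (Ideal.Quotient.mk P (X j))

omit [P.IsPrime] in
/-- `K[X] → A → F` is the evaluation at the coordinate functions. [folklore] -/
theorem algebraMap_mk_eq_aeval_xF (g : MvPolynomial (Fin n) K) :
    algebraMap (Aff P) (Fun P) (Ideal.Quotient.mk P g) = aeval (xF P) g := by
  have : (aeval (xF P) : MvPolynomial (Fin n) K →ₐ[K] Fun P) =
      (IsScalarTower.toAlgHom K (Aff P) (Fun P)).comp (Ideal.Quotient.mkₐ K P) := by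
    apply MvPolynomial.algHom_ext
    intro j
    simp [xF]
  rw [this]
  rfl

/-- The coordinate functions generate the function field over `K`. [folklore] -/
theorem adjoin_range_xF_eq_top : IntermediateField.adjoin K (Set.range (xF P)) = ⊤ := by
  rw [eq_top_iff]
  intro z _
  obtain ⟨a, b, hb, rfl⟩ := IsFractionRing.div_surjective (A := Aff P) z
  have hmem : ∀ c : Aff P, algebraMap (Aff P) (Fun P) c ∈
      IntermediateField.adjoin K (Set.range (xF P)) := by
    intro c
    obtain ⟨g, rfl⟩ := Ideal.Quotient.mk_surjective c
    rw [algebraMap_mk_eq_aeval_xF]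
    refine IntermediateField.algebra_adjoin_le_adjoin _ _ ?_
    rw [Algebra.adjoin_range_eq_range_aeval]
    exact ⟨g, rfl⟩
  exact div_mem (hmem a) (hmem b)


end Setup

/-! ### Weighted homogenisation -/

section Homog

variable {K : Type*} [Field K] {n d : ℕ}

/-- Weighted homogenisation of `g(w₁/δ, …, wₙ/δ)`: the polynomial
`Σ_e g_e · δ^{N - |e|} · ∏_j w_j^{e_j}` (`N = deg g`), an element of `K[Y][T]`. [folklore] -/
def homog (δ : MvPolynomial (Fin d) K) (w : Fin n → (MvPolynomial (Fin d) K)[X])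
    (g : MvPolynomial (Fin n) K) : (MvPolynomial (Fin d) K)[X] :=
  ∑ e ∈ g.support, Polynomial.C (C (g.coeff e) * δ ^ (g.totalDegree - e.degree)) *
    ∏ j, w j ^ (e j)

/-- The evaluation identity: under any ring homomorphism `φ` to a field with `φ(δ) ≠ 0`,
`φ(homog g) = φ(δ)^N · g(φ(w₁)/φ(δ), …, φ(wₙ)/φ(δ))`. [folklore] -/
theorem map_homog_eq {L : Type*} [Field L] (φ : (MvPolynomial (Fin d) K)[X] →+* L)
    (δ : MvPolynomial (Fin d) K) (w : Fin n → (MvPolynomial (Fin d) K)[X])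
    (g : MvPolynomial (Fin n) K) (hD : φ (Polynomial.C δ) ≠ 0) :
    φ (homog δ w g) = φ (Polynomial.C δ) ^ g.totalDegree *
      MvPolynomial.eval (fun j => φ (w j) / φ (Polynomial.C δ))
        (MvPolynomial.map (φ.comp (Polynomial.C.comp C)) g) := by
  classical
  set D := φ (Polynomial.C δ) with hDdef
  set ι : K →+* L := φ.comp (Polynomial.C.comp C) with hι
  rw [MvPolynomial.eval_eq', MvPolynomial.support_map_of_injective _ ι.injective, Finset.mul_sum,
    homog, map_sum]
  refine Finset.sum_congr rfl fun e he => ?_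
  have hle : e.degree ≤ g.totalDegree := by
    rw [Finsupp.degree]
    have := MvPolynomial.le_totalDegree he
    simpa [Finsupp.sum] using this
  rw [MvPolynomial.coeff_map, map_mul, map_prod]
  simp only [map_pow, map_mul]
  rw [show φ (Polynomial.C (C (g.coeff e))) = ι (g.coeff e) from rfl]
  simp only [← hDdef]
  have hprod : (∏ j, (φ (w j) / D) ^ (e j)) = (∏ j, φ (w j) ^ (e j)) / D ^ e.degree := by
    simp_rw [div_pow]
    rw [Finset.prod_div_distrib, Finset.prod_pow_eq_pow_sum]
    congr 2
    rw [Finsupp.degree]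
    exact (Finset.sum_subset (Finset.subset_univ _) fun j _ hj => by
      simpa using hj).symm
  rw [hprod]
  have hDpow : D ^ g.totalDegree = D ^ (g.totalDegree - e.degree) * D ^ e.degree := by
    rw [← pow_add, Nat.sub_add_cancel hle]
  rw [hDpow]
  have hDe : D ^ e.degree ≠ 0 := pow_ne_zero _ hD
  field_simp

/-- The evaluation identity in polynomial-identity form (no division): if `x_j · φ(δ) = φ(w_j)`
for all `j`, then `φ(homog g) = φ(δ)^N · g(x)`. [folklore] -/
theorem map_homog_eq_of_mul_eq {L : Type*} [Field L] (φ : (MvPolynomial (Fin d) K)[X] →+* L)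
    (δ : MvPolynomial (Fin d) K) (w : Fin n → (MvPolynomial (Fin d) K)[X])
    (g : MvPolynomial (Fin n) K) (hD : φ (Polynomial.C δ) ≠ 0) (x : Fin n → L)
    (hx : ∀ j, x j * φ (Polynomial.C δ) = φ (w j)) :
    φ (homog δ w g) = φ (Polynomial.C δ) ^ g.totalDegree *
      MvPolynomial.eval x (MvPolynomial.map (φ.comp (Polynomial.C.comp C)) g) := by
  rw [map_homog_eq φ δ w g hD]
  have : (fun j => φ (w j) / φ (Polynomial.C δ)) = x := funext fun j => by
    rw [← hx j, mul_div_cancel_right₀ _ hD]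
  rw [this]


end Homog

/-! ### The model -/

section Model

variable {K : Type*} [Field K] {n : ℕ} (P : Ideal (MvPolynomial (Fin n) K)) [P.IsPrime]

/-- Substitution `q(Y, T) ↦ q(X∘emb, U)` from `K[Y][T]` to `K[X]`. [folklore] -/
def subst {d : ℕ} (emb : Fin d ↪ Fin n) (U : MvPolynomial (Fin n) K)
    (q : (MvPolynomial (Fin d) K)[X]) : MvPolynomial (Fin n) K :=
  Polynomial.eval₂ (rename emb : MvPolynomial (Fin d) K →ₐ[K] MvPolynomial (Fin n) K).toRingHom U q

/-- The point `x* ∈ Kⁿ` attached to `(y, v) ∈ K^d × K` by the parametrisation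
`x_j = w_j(y, v)/δ(y)`. [folklore] -/
def pt {d : ℕ} (δ : MvPolynomial (Fin d) K) (w : Fin n → (MvPolynomial (Fin d) K)[X])
    (y : Fin d → K) (v : K) : Fin n → K :=
  fun j => ((w j).map (eval y)).eval v / eval y δ

/-- **A birational hypersurface model of `V(P)` in coordinates** (data and properties; see the
module docstring).  Fields: the dimension `d` with the chosen coordinates `emb`, the primitive
polynomial `U`, the minimal polynomial `m ∈ K[Y₁..Y_d][T]`, the denominator `δ`, the Bézout data
`a m + b m' = ρ`, the numerators `w_j`; and the facts `dim A = d`, `m` monic irreducible of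
positive degree, `δ, ρ ≠ 0`, injectivity of `K[Y] → K[X]/P` along `emb`, `m(X∘emb, U) ∈ P`,
`δ X_j - w_j(X∘emb, U) ∈ P`, and the point-level surjectivity `point_spec`.
[cite: Hartshorne1977, Ch. I Prop. 4.9] -/
structure HypersurfaceModel where
  /-- the dimension `d = dim K[X]/P` -/
  d : ℕ
  /-- the coordinates forming a separating transcendence basis -/
  emb : Fin d ↪ Fin n
  /-- a lift to `K[X]` of the primitive element `u` -/
  U : MvPolynomial (Fin n) K
  /-- the minimal polynomial of `u` over `K[Y]` -/
  m : (MvPolynomial (Fin d) K)[X]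
  /-- the common denominator of the coordinates as polynomials in `u` -/
  δ : MvPolynomial (Fin d) K
  /-- the Bézout element `ρ = a m + b m'` -/
  ρ : MvPolynomial (Fin d) K
  /-- the numerators: `δ x_j = w_j(u)` -/
  w : Fin n → (MvPolynomial (Fin d) K)[X]
  /-- Bézout coefficient -/
  a : (MvPolynomial (Fin d) K)[X]
  /-- Bézout coefficient -/
  b : (MvPolynomial (Fin d) K)[X]
  dim_eq : ringKrullDim (MvPolynomial (Fin n) K ⧸ P) = d
  monic : m.Monic
  natDegree_pos : 0 < m.natDegree
  irreducible : Irreducible m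
  δ_ne_zero : δ ≠ 0
  ρ_ne_zero : ρ ≠ 0
  bezout : a * m + b * Polynomial.derivative m = Polynomial.C ρ
  eq_zero_of_rename_mem : ∀ q : MvPolynomial (Fin d) K, rename emb q ∈ P → q = 0
  subst_m_mem : subst emb U m ∈ P
  graph_mem : ∀ j, rename emb δ * X j - subst emb U (w j) ∈ P
  point_spec : ∀ (y : Fin d → K) (v : K), (m.map (eval y)).eval v = 0 → eval y δ ≠ 0 →
    (∀ g ∈ P, eval (pt δ w y v) g = 0) ∧ eval (pt δ w y v) U = v ∧ ∀ k, pt δ w y v (emb k) = y k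

set_option synthInstance.maxHeartbeats 400000 in
set_option maxHeartbeats 800000 in
/-- **Existence of a birational hypersurface model** of `V(P)` for a prime `P ⊆ K[X₁, …, Xₙ]`
over a perfect field `K` (Hartshorne I Prop. 4.9 in coordinates; proof in the module
docstring: separating transcendence basis among the coordinates, primitive element made
integral over `K[Y]`, minimal polynomial over the integrally closed `K[Y]`, denominators cleared
with `IsLocalization.integerNormalization`, Bézout from separability, surjectivity through
`homog`). [cite: Hartshorne1977, Ch. I Prop. 4.9] -/
theorem HypersurfaceModel.nonempty [PerfectField K] : Nonempty (HypersurfaceModel P) := by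
  classical
  -- Step 1: a separating transcendence basis among the coordinates
  obtain ⟨s, hs, hsep⟩ :=
    exists_finset_isTranscendenceBasis_and_isSeparable_of_perfectField (xF P)
      (adjoin_range_xF_eq_top P)
  set d := s.card with hd
  let emb : Fin d ↪ Fin n :=
    ⟨fun k => ((s.equivFin.symm k : s) : Fin n), fun a b h =>
      s.equivFin.symm.injective (Subtype.ext h)⟩
  let y' : Fin d → Fun P := fun k => xF P (emb k)
  have hy' : IsTranscendenceBasis K y' := hs.comp_equiv s.equivFin.symm
  have hrange : xF P '' (s : Set (Fin n)) = Set.range y' := by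
    ext z
    constructor
    · rintro ⟨i, hi, rfl⟩
      refine ⟨s.equivFin ⟨i, hi⟩, ?_⟩
      simp [y', emb]
    · rintro ⟨k, rfl⟩
      exact ⟨_, (s.equivFin.symm k).2, rfl⟩
  rw [hrange] at hsep
  -- the dimension: `dim A = trdeg_K Frac A = d`
  have hdim : ringKrullDim (Aff P) = d := by
    have h1 := Literature.RingTheory.KrullDimension.ringKrullDim_eq_trdeg K (Aff P)
    have h2 : Algebra.trdeg K (Fun P) = Algebra.trdeg K (Aff P) := by
      haveI : Algebra.IsAlgebraic (Aff P) (Fun P) :=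
        IsLocalization.isAlgebraic _ (nonZeroDivisors (Aff P))
      have h := trdeg_add_eq K (Aff P) (A := Fun P)
      rw [trdeg_eq_zero (R := Aff P) (A := Fun P), add_zero] at h
      exact h.symm
    have h3 := hy'.lift_cardinalMk_eq_trdeg
    rw [Cardinal.mk_fintype, Fintype.card_fin, Cardinal.lift_natCast, h2] at h3
    rw [h1, Cardinal.lift_eq_nat_iff.1 h3.symm, Cardinal.toNat_natCast]
  -- Step 2: `(MvPolynomial (Fin d) K) = K[Y]` and the algebra structures
  let toA : MvPolynomial (Fin d) K →ₐ[K] Aff P := aeval fun k => Ideal.Quotient.mk P (X (emb k))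
  letI iRA : Algebra (MvPolynomial (Fin d) K) (Aff P) := toA.toRingHom.toAlgebra
  haveI : IsScalarTower K (MvPolynomial (Fin d) K) (Aff P) :=
    IsScalarTower.of_algebraMap_eq fun c => (toA.commutes c).symm
  -- `Algebra K[Y] (Frac A)` and the tower `K[Y] → A → Frac A` come from Mathlib's instances
  have hRAF : ∀ q : MvPolynomial (Fin d) K, algebraMap (MvPolynomial (Fin d) K) (Fun P) q =
      algebraMap (Aff P) (Fun P) (toA q) := fun q =>
    IsScalarTower.algebraMap_apply (MvPolynomial (Fin d) K) (Aff P) (Fun P) q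
  have hRF : ∀ q : (MvPolynomial (Fin d) K), algebraMap (MvPolynomial (Fin d) K) (Fun P) q = aeval y' q := by
    intro q
    have h : (IsScalarTower.toAlgHom K (Aff P) (Fun P)).comp toA = aeval y' := by
      apply MvPolynomial.algHom_ext
      intro k
      simp [toA, y', xF]
    rw [hRAF]
    exact DFunLike.congr_fun h q
  haveI : IsScalarTower K (MvPolynomial (Fin d) K) (Fun P) := IsScalarTower.of_algebraMap_eq fun c => by
    rw [hRF, MvPolynomial.algebraMap_eq, aeval_C]
  have hinjRF : Function.Injective (algebraMap (MvPolynomial (Fin d) K) (Fun P)) := by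
    have h := hy'.1
    rw [algebraicIndependent_iff_injective_aeval] at h
    intro q₁ q₂ hq
    apply h
    change aeval y' q₁ = aeval y' q₂
    rw [← hRF, ← hRF, hq]
  have hinjRA : Function.Injective (algebraMap (MvPolynomial (Fin d) K) (Aff P)) := fun q₁ q₂ hq =>
    hinjRF (by rw [hRAF, hRAF]; exact congrArg _ hq)
  -- the subfield `K₀ = K(y')`
  set K₀ : IntermediateField K (Fun P) := IntermediateField.adjoin K (Set.range y') with hK₀
  have hmemK₀ : ∀ q : (MvPolynomial (Fin d) K), aeval y' q ∈ K₀ := fun q => by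
    apply IntermediateField.algebra_adjoin_le_adjoin
    rw [Algebra.adjoin_range_eq_range_aeval]
    exact ⟨q, rfl⟩
  let toK₀ : (MvPolynomial (Fin d) K) →ₐ[K] K₀ := (aeval y').codRestrict K₀.toSubalgebra hmemK₀
  letI iRK₀ : Algebra (MvPolynomial (Fin d) K) K₀ := toK₀.toRingHom.toAlgebra
  have hRK₀ : ∀ q : (MvPolynomial (Fin d) K), ((algebraMap (MvPolynomial (Fin d) K) K₀ q : K₀) : Fun P) = aeval y' q := fun q => rfl
  haveI : IsScalarTower (MvPolynomial (Fin d) K) K₀ (Fun P) := IsScalarTower.of_algebraMap_eq fun q => by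
    rw [hRF]; rfl
  let e : FractionRing (MvPolynomial (Fin d) K) ≃ₐ[(MvPolynomial (Fin d) K)] K₀ :=
    AlgEquiv.ofRingEquiv (f := hy'.1.aevalEquivField.toRingEquiv) fun q => by
      apply Subtype.ext
      change ((hy'.1.aevalEquivField (algebraMap (MvPolynomial (Fin d) K) (FractionRing (MvPolynomial (Fin d) K)) q) : K₀) : Fun P) = _
      rw [AlgebraicIndependent.aevalEquivField_algebraMap_apply_coe, hRK₀]
  haveI : IsFractionRing (MvPolynomial (Fin d) K) K₀ := IsLocalization.isLocalization_of_algEquiv (nonZeroDivisors (MvPolynomial (Fin d) K)) e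
  -- Step 3: `F` is finite separable over `K₀`
  haveI : Algebra.IsAlgebraic K₀ (Fun P) := hy'.isAlgebraic_field
  haveI : Algebra.EssFiniteType K (Fun P) := by
    rw [← IntermediateField.fg_top_iff]
    exact ⟨(Set.toFinite (Set.range (xF P))).toFinset, by simpa using adjoin_range_xF_eq_top P⟩
  haveI : Module.Finite K₀ (Fun P) := by
    apply +allowSynthFailures Algebra.finite_of_essFiniteType_of_isAlgebraic
    exact .of_comp K _ _
  haveI : Algebra.IsSeparable K₀ (Fun P) := hsep
  -- Step 4: a primitive element in `A`, integral over `(MvPolynomial (Fin d) K)`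
  have halgA : ∀ z : Aff P, IsAlgebraic (MvPolynomial (Fin d) K) z := fun z => by
    have h1 : IsAlgebraic K₀ (algebraMap (Aff P) (Fun P) z) := Algebra.IsAlgebraic.isAlgebraic _
    have h2 : IsAlgebraic (MvPolynomial (Fin d) K) (algebraMap (Aff P) (Fun P) z) :=
      (IsFractionRing.isAlgebraic_iff (MvPolynomial (Fin d) K) K₀ (Fun P)).mpr h1
    exact (isAlgebraic_algebraMap_iff (IsFractionRing.injective (Aff P) (Fun P))).mp h2
  obtain ⟨γ, hγ⟩ := Field.exists_primitive_element K₀ (Fun P)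
  obtain ⟨α, β, hβ, hγeq⟩ := IsFractionRing.div_surjective (A := Aff P) γ
  obtain ⟨c₁, r₁, hr₁, hr₁eq⟩ := (halgA β).exists_smul_eq_mul α hβ
  obtain ⟨r₂, hr₂, hint⟩ := (halgA c₁).exists_integral_multiple
  set u : Aff P := r₂ • c₁ with hu
  set uF : Fun P := algebraMap (Aff P) (Fun P) u with huF
  have huF_int : IsIntegral (MvPolynomial (Fin d) K) uF := hint.algebraMap
  have hβF : algebraMap (Aff P) (Fun P) β ≠ 0 :=
    (map_ne_zero_iff _ (IsFractionRing.injective (Aff P) (Fun P))).mpr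
      (nonZeroDivisors.ne_zero hβ)
  have hr₁F : algebraMap (MvPolynomial (Fin d) K) (Fun P) r₁ ≠ 0 := (map_ne_zero_iff _ hinjRF).mpr hr₁
  have hr₂F : algebraMap (MvPolynomial (Fin d) K) (Fun P) r₂ ≠ 0 := (map_ne_zero_iff _ hinjRF).mpr hr₂
  have huγ : uF = γ * (algebraMap (MvPolynomial (Fin d) K) (Fun P) r₂ * algebraMap (MvPolynomial (Fin d) K) (Fun P) r₁) := by
    -- `r₁ • α = β c₁`, `γ = α/β`, `u = r₂ • c₁`
    have h1 : algebraMap (MvPolynomial (Fin d) K) (Fun P) r₁ * algebraMap (Aff P) (Fun P) α =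
        algebraMap (Aff P) (Fun P) β * algebraMap (Aff P) (Fun P) c₁ := by
      have := congrArg (algebraMap (Aff P) (Fun P)) hr₁eq
      rw [Algebra.smul_def, map_mul, map_mul, ← IsScalarTower.algebraMap_apply] at this
      exact this
    have h2 : uF = algebraMap (MvPolynomial (Fin d) K) (Fun P) r₂ * algebraMap (Aff P) (Fun P) c₁ := by
      rw [huF, hu, Algebra.smul_def, map_mul, ← IsScalarTower.algebraMap_apply]
    have h3 : algebraMap (Aff P) (Fun P) c₁ =
        algebraMap (MvPolynomial (Fin d) K) (Fun P) r₁ * algebraMap (Aff P) (Fun P) α / algebraMap (Aff P) (Fun P) β := by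
      rw [eq_div_iff hβF]
      linear_combination -h1
    rw [h2, h3, ← hγeq]
    field_simp
  have hutop : K₀⟮uF⟯ = ⊤ := by
    rw [eq_top_iff, ← hγ, IntermediateField.adjoin_simple_le_iff]
    have hγ' : γ = uF * (algebraMap (MvPolynomial (Fin d) K) (Fun P) r₂ * algebraMap (MvPolynomial (Fin d) K) (Fun P) r₁)⁻¹ := by
      rw [huγ, mul_inv_cancel_right₀ (mul_ne_zero hr₂F hr₁F)]
    rw [hγ']
    refine mul_mem (IntermediateField.mem_adjoin_simple_self K₀ uF) (inv_mem (mul_mem ?_ ?_))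
    · rw [IsScalarTower.algebraMap_apply (MvPolynomial (Fin d) K) K₀ (Fun P)]
      exact IntermediateField.algebraMap_mem _ _
    · rw [IsScalarTower.algebraMap_apply (MvPolynomial (Fin d) K) K₀ (Fun P)]
      exact IntermediateField.algebraMap_mem _ _
  -- Step 5: the minimal polynomial
  set m : (MvPolynomial (Fin d) K)[X] := minpoly (MvPolynomial (Fin d) K) uF with hm
  have hm_monic : m.Monic := minpoly.monic huF_int
  have hmK₀ : minpoly K₀ uF = m.map (algebraMap (MvPolynomial (Fin d) K) K₀) :=
    minpoly.isIntegrallyClosed_eq_field_fractions' K₀ huF_int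
  have hint₀ : IsIntegral K₀ uF := huF_int.tower_top
  have hdeg : 0 < m.natDegree := minpoly.natDegree_pos huF_int
  have hirr : Irreducible m := minpoly.irreducible huF_int
  -- Step 6: Bezout identity from separability
  have hsepu : (minpoly K₀ uF).Separable := Algebra.IsSeparable.isSeparable K₀ uF
  have hcop : IsCoprime (m.map (algebraMap (MvPolynomial (Fin d) K) K₀))
      (Polynomial.derivative (m.map (algebraMap (MvPolynomial (Fin d) K) K₀))) := by
    rw [← hmK₀]; exact hsepu
  obtain ⟨a₀, b₀, hab⟩ := hcop
  rw [Polynomial.derivative_map] at hab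
  obtain ⟨αa, hαa, ha⟩ := IsLocalization.integerNormalization_spec (nonZeroDivisors (MvPolynomial (Fin d) K)) a₀
  obtain ⟨αb, hαb, hb⟩ := IsLocalization.integerNormalization_spec (nonZeroDivisors (MvPolynomial (Fin d) K)) b₀
  set a : (MvPolynomial (Fin d) K)[X] := Polynomial.C αb *
    IsLocalization.integerNormalization (nonZeroDivisors (MvPolynomial (Fin d) K)) a₀ with ha_def
  set b : (MvPolynomial (Fin d) K)[X] := Polynomial.C αa *
    IsLocalization.integerNormalization (nonZeroDivisors (MvPolynomial (Fin d) K)) b₀ with hb_def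
  set ρ : (MvPolynomial (Fin d) K) := αa * αb with hρ
  have hρ0 : ρ ≠ 0 := mul_ne_zero (nonZeroDivisors.ne_zero hαa) (nonZeroDivisors.ne_zero hαb)
  have hbez : a * m + b * Polynomial.derivative m = Polynomial.C ρ := by
    apply Polynomial.map_injective (algebraMap (MvPolynomial (Fin d) K) K₀) (IsFractionRing.injective (MvPolynomial (Fin d) K) K₀)
    simp only [ha_def, hb_def, hρ, Polynomial.map_add, Polynomial.map_mul, Polynomial.map_C, ha, hb,
      map_mul, Algebra.smul_def, Polynomial.algebraMap_apply]
    linear_combination (Polynomial.C (algebraMap (MvPolynomial (Fin d) K) K₀ αa) *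
      Polynomial.C (algebraMap (MvPolynomial (Fin d) K) K₀ αb)) * hab
  -- Step 7: the coordinates as polynomials in `uF` with a common denominator `δ`
  have hxmem : ∀ j, ∃ p : K₀[X], Polynomial.aeval uF p = xF P j := fun j => by
    have h : xF P j ∈ K₀⟮uF⟯ := by rw [hutop]; exact IntermediateField.mem_top
    rw [← IntermediateField.mem_toSubalgebra,
      IntermediateField.adjoin_simple_toSubalgebra_of_isAlgebraic hint₀.isAlgebraic,
      Algebra.adjoin_singleton_eq_range_aeval] at h
    obtain ⟨p, hp⟩ := h
    exact ⟨p, hp⟩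
  choose p hp using hxmem
  have hWex : ∀ j, ∃ (c : (MvPolynomial (Fin d) K)) (W : (MvPolynomial (Fin d) K)[X]), c ≠ 0 ∧
      Polynomial.aeval uF W = algebraMap (MvPolynomial (Fin d) K) (Fun P) c * xF P j := fun j => by
    obtain ⟨c, hc, hcW⟩ := IsLocalization.integerNormalization_spec (nonZeroDivisors (MvPolynomial (Fin d) K)) (p j)
    refine ⟨c, IsLocalization.integerNormalization (nonZeroDivisors (MvPolynomial (Fin d) K)) (p j),
      nonZeroDivisors.ne_zero hc, ?_⟩
    rw [← Polynomial.aeval_map_algebraMap K₀, hcW, Algebra.smul_def, Polynomial.algebraMap_apply,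
      map_mul, Polynomial.aeval_C, hp, ← IsScalarTower.algebraMap_apply]
  choose c W hc0 hcW using hWex
  set δ : (MvPolynomial (Fin d) K) := ∏ j, c j with hδ
  have hδ0 : δ ≠ 0 := Finset.prod_ne_zero_iff.mpr fun j _ => hc0 j
  set w : Fin n → (MvPolynomial (Fin d) K)[X] := fun j => Polynomial.C (∏ k ∈ Finset.univ.erase j, c k) * W j with hw_def
  have hw : ∀ j, Polynomial.aeval uF (w j) = algebraMap (MvPolynomial (Fin d) K) (Fun P) δ * xF P j := fun j => by
    simp only [hw_def, map_mul, Polynomial.aeval_C, hcW, hδ]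
    rw [← mul_assoc, ← map_mul, Finset.prod_erase_mul _ _ (Finset.mem_univ j)]
  haveI : Module.IsTorsionFree (MvPolynomial (Fin d) K) (Fun P) :=
    (Module.isTorsionFree_iff_algebraMap_injective).mpr hinjRF
  -- Step 8: the key divisibility: `R[T]`-relations of `uF` vanish at the zeros of `m`
  have hkey : ∀ q : (MvPolynomial (Fin d) K)[X], Polynomial.aeval uF q = 0 → ∀ (y : Fin d → K) (v : K),
      (m.map (eval y)).eval v = 0 → (q.map (eval y)).eval v = 0 := by
    intro q hq y v hmv
    obtain ⟨t, ht⟩ := minpoly.isIntegrallyClosed_dvd huF_int hq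
    rw [ht, Polynomial.map_mul, Polynomial.eval_mul, hmv, zero_mul]
  -- Step 9: lift `u` to `K[X]`; the substitution facts
  obtain ⟨U, hU⟩ := Ideal.Quotient.mk_surjective u
  have hmkren : ∀ q : (MvPolynomial (Fin d) K), Ideal.Quotient.mk P (rename emb q) = toA q := by
    intro q
    have h : (Ideal.Quotient.mkₐ K P).comp (rename emb) = toA := by
      apply MvPolynomial.algHom_ext; intro k; simp [toA]
    exact DFunLike.congr_fun h q
  have hsubst : ∀ q : (MvPolynomial (Fin d) K)[X], Ideal.Quotient.mk P (subst emb U q) = Polynomial.aeval u q := by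
    intro q
    simp only [subst]
    rw [Polynomial.hom_eval₂, hU, Polynomial.aeval_def]
    congr 1
    exact RingHom.ext fun q' => hmkren q'
  have haevalF : ∀ q : (MvPolynomial (Fin d) K)[X],
      algebraMap (Aff P) (Fun P) (Polynomial.aeval u q) = Polynomial.aeval uF q := by
    intro q; rw [huF, Polynomial.aeval_algebraMap_apply]
  have hmemP : ∀ q : (MvPolynomial (Fin d) K)[X], Polynomial.aeval uF q = 0 → subst emb U q ∈ P := by
    intro q hq
    rw [← Ideal.Quotient.eq_zero_iff_mem, hsubst]
    apply IsFractionRing.injective (Aff P) (Fun P)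
    rw [haevalF, hq, map_zero]
  have hm_mem : subst emb U m ∈ P := hmemP m (minpoly.aeval (MvPolynomial (Fin d) K) uF)
  have hxFmk : ∀ j, algebraMap (Aff P) (Fun P) (Ideal.Quotient.mk P (X j)) = xF P j := fun j => rfl
  have hw_mem : ∀ j, rename emb δ * X j - subst emb U (w j) ∈ P := by
    intro j
    rw [← Ideal.Quotient.eq_zero_iff_mem, map_sub, map_mul, hmkren, hsubst]
    apply IsFractionRing.injective (Aff P) (Fun P)
    rw [map_sub, map_mul, haevalF, hw, map_zero, ← hRAF, hxFmk, sub_self]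
  have hinjP : ∀ q : (MvPolynomial (Fin d) K), rename emb q ∈ P → q = 0 := by
    intro q hq
    rw [← Ideal.Quotient.eq_zero_iff_mem, hmkren] at hq
    exact hinjRF (by rw [hRAF, hq, map_zero, map_zero])
  -- Step 10: the two evaluation homomorphisms of `R[T]`
  set φF : (MvPolynomial (Fin d) K)[X] →+* Fun P := (Polynomial.aeval uF : (MvPolynomial (Fin d) K)[X] →ₐ[(MvPolynomial (Fin d) K)] Fun P).toRingHom with hφF
  have hφF_apply : ∀ q, φF q = Polynomial.aeval uF q := fun q => rfl
  have hφF_C : φF (Polynomial.C δ) = algebraMap (MvPolynomial (Fin d) K) (Fun P) δ := by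
    rw [hφF_apply, Polynomial.aeval_C]
  have hφF_CC : φF.comp (Polynomial.C.comp C) = algebraMap K (Fun P) := by
    ext c
    change Polynomial.aeval uF (Polynomial.C (C c)) = algebraMap K (Fun P) c
    rw [Polynomial.aeval_C, IsScalarTower.algebraMap_apply K (MvPolynomial (Fin d) K) (Fun P), MvPolynomial.algebraMap_eq]
  have hδF : φF (Polynomial.C δ) ≠ 0 := by
    rw [hφF_C]; exact (map_ne_zero_iff _ hinjRF).mpr hδ0
  have hxF : ∀ j, xF P j * φF (Polynomial.C δ) = φF (w j) := fun j => by
    rw [hφF_C, hφF_apply, hw, mul_comm]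
  have hevalF : ∀ g : MvPolynomial (Fin n) K,
      MvPolynomial.eval (xF P) (MvPolynomial.map (φF.comp (Polynomial.C.comp C)) g) =
        algebraMap (Aff P) (Fun P) (Ideal.Quotient.mk P g) := fun g => by
    rw [hφF_CC, MvPolynomial.eval_map, ← MvPolynomial.aeval_def, algebraMap_mk_eq_aeval_xF]
  have hhomogF : ∀ g : MvPolynomial (Fin n) K,
      φF (homog δ w g) = φF (Polynomial.C δ) ^ g.totalDegree *
        algebraMap (Aff P) (Fun P) (Ideal.Quotient.mk P g) := fun g => by
    rw [map_homog_eq_of_mul_eq φF δ w g hδF (xF P) hxF, hevalF]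
  refine ⟨⟨d, emb, U, m, δ, ρ, w, a, b, hdim, hm_monic, hdeg, hirr, hδ0, hρ0, hbez, hinjP, hm_mem,
    hw_mem, fun y v hmv hδy => ?_⟩⟩
  set φK : (MvPolynomial (Fin d) K)[X] →+* K := Polynomial.eval₂RingHom (MvPolynomial.eval y) v with hφK
  have hφK_apply : ∀ q : (MvPolynomial (Fin d) K)[X], φK q = (q.map (MvPolynomial.eval y)).eval v := fun q => by
    rw [Polynomial.eval_map]; rfl
  have hφK_C : φK (Polynomial.C δ) = MvPolynomial.eval y δ := by
    rw [hφK]; exact Polynomial.eval₂_C _ _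
  have hφK_CC : φK.comp (Polynomial.C.comp C) = RingHom.id K := by
    ext c
    change φK (Polynomial.C (C c)) = c
    rw [hφK, Polynomial.coe_eval₂RingHom, Polynomial.eval₂_C, MvPolynomial.eval_C]
  have hδK : φK (Polynomial.C δ) ≠ 0 := by rwa [hφK_C]
  set x := pt δ w y v with hxdef
  have hxK : ∀ j, x j * φK (Polynomial.C δ) = φK (w j) := fun j => by
    rw [hφK_C, hφK_apply, hxdef, pt, div_mul_cancel₀ _ hδy]
  have hhomogK : ∀ g : MvPolynomial (Fin n) K,
      φK (homog δ w g) = (MvPolynomial.eval y δ) ^ g.totalDegree * MvPolynomial.eval x g := by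
    intro g
    rw [map_homog_eq_of_mul_eq φK δ w g hδK x hxK, hφK_CC, MvPolynomial.map_id, hφK_C]
  -- transport of relations from `F` to `K`
  have htrans : ∀ q : (MvPolynomial (Fin d) K)[X], φF q = 0 → φK q = 0 := fun q hq => by
    rw [hφK_apply]; exact hkey q hq y v hmv
  have hpow : (MvPolynomial.eval y δ) ^ U.totalDegree ≠ 0 := pow_ne_zero _ hδy
  refine ⟨fun g hg => ?_, ?_, fun k => ?_⟩
  · -- (d1)
    have h1 : φF (homog δ w g) = 0 := by
      rw [hhomogF, Ideal.Quotient.eq_zero_iff_mem.mpr hg, map_zero, mul_zero]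
    have h2 := htrans _ h1
    rw [hhomogK] at h2
    exact (mul_eq_zero.mp h2).resolve_left (pow_ne_zero _ hδy)
  · -- (d2)
    have h1 : φF (homog δ w U - Polynomial.C δ ^ U.totalDegree * Polynomial.X) = 0 := by
      rw [map_sub, map_mul, hhomogF, hU, ← huF, map_pow]
      rw [hφF_apply Polynomial.X, Polynomial.aeval_X, sub_self]
    have h2 := htrans _ h1
    rw [map_sub, map_mul, hhomogK, map_pow, hφK_C] at h2
    rw [hφK, Polynomial.coe_eval₂RingHom, Polynomial.eval₂_X] at h2
    exact mul_left_cancel₀ hpow (sub_eq_zero.mp h2)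
  · -- (d3)
    have h1 : φF (w (emb k) - Polynomial.C δ * Polynomial.C (X k)) = 0 := by
      rw [map_sub, ← hxF, map_mul, hφF_apply (Polynomial.C (X k)), Polynomial.aeval_C, hRF (X k),
        aeval_X]
      change xF P (emb k) * φF (Polynomial.C δ) - φF (Polynomial.C δ) * xF P (emb k) = 0
      ring
    have h2 := htrans _ h1
    rw [map_sub, sub_eq_zero, ← hxK, map_mul, hφK_C] at h2
    have h3 : φK (Polynomial.C (X k)) = y k := by
      rw [hφK, Polynomial.coe_eval₂RingHom, Polynomial.eval₂_C, MvPolynomial.eval_X]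
    rw [h3] at h2
    exact mul_right_cancel₀ hδy (h2.trans (mul_comm _ _))


end Model

end Literature.RingTheory.NoetherNormalization

end
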